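import Mathlib
import Literature.Analysis.FluidPDE.Tao2016AveragedNS.ShiftSetCascadeFlows
import Literature.Analysis.FluidPDE.Tao2016AveragedNS.ShiftSetCascadeFlux
import Summits.NavierStokesRegularity.NavierStokesRegularity.Theorems.TaoLadderRungTwoFlatMirrorTableDefs
import Summits.NavierStokesRegularity.NavierStokesRegularity.Theorems.TaoLadderRungTwoFlatMirrorField
import Summits.NavierStokesRegularity.NavierStokesRegularity.Theorems.TaoLadderRungTwoFlatPulseDefs
import HarnessLib

/-!
# The SHELL-ENERGY FLUX IDENTITY for exact lattice solutions (`ė_n = T_{n−1} − T_n`) and the bond flux of the mirror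
  table in closed form, with its amplitude × energy bound
  (helper for item stmt-NavierStokesRegularity-22987 `FlatGapCertificatesV2`, crux K_A♭ of route TaoLadderRungTwoFlat;
  cell harvest/h2-tao-ladder, p1 g20 — the «elementary flux identity» invoked by theory-1 g36's SPLIT-T48 junk-energy
  clause (bus l.673): `ė_n = T_{n−1} − T_n`, `T_n = λ^{5n/2} v_n a_{n+1}(v_n + ε a_{n+1})`, energy-front speed
  `≲ sup|X|`)

For ANY family `X` solving the exact `𝕊`-lattice at every site and time (`HasDerivAt (X i n) (quadTermOn 𝕊 ε₀ α X i n t) t`),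
any scale ratio `1 + ε₀`, nearest-neighbour slot-closed `𝕊` and a table cancelling on `𝕊`, the shell energy
`e_n = ½ Σᵢ X_{i,n}²` satisfies the exact local conservation law `ė_n = B_𝕊(n−1) − B_𝕊(n)` with the tree's bond flux
`botSumOn` (`Literature…ShiftSetCascadeFlux`: `sum_quadTermOn_mul`, `botSumOn_eq_neg_topSumOn`) — a FINITE identity per
shell, no summability needed:

* `hasDerivAt_shellEnergy` — the flux identity; `shellEnergy_sub_eq_integral` — its integrated form;
* `botSumOn_mirrorTable` — for `T♭`: `B(n) = (1+ε₀)^{5n/2}·(a_{n+1} v_n² + δ a_{n+1}² v_n) = λ^{5n/2} v_n a_{n+1}(v_n + δ a_{n+1})`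
  (`a = X 0`, `v = X 1`); `abs_botSumOn_mirrorTable_le` — `|B(n)| ≤ (1+ε₀)^{5n/2}·m·(v_n² + |δ| a_{n+1}²)` with
  `m = max(|a_{n+1}|, |v_n|)`: energy crosses the bond `n | n+1` no faster than (local amplitude) × (local energy) —
  the «energy-front speed ≤ (1+|δ|)·sup|X|» bound in differential form;
* `MirrorPulse.IsGlobalSol.hasDerivAt_shellEnergy` — the λ₀ = 1 mirror-lattice instance.

HONEST FRAMING: finite algebra/calculus about MODEL lattices (Tao 2016 §4 vocabulary, shift-set parametrised); nothing
certified; nothing here is a statement about the Navier–Stokes equations.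
-/

noncomputable section

-- the sub-problem namespace repeats the summit name by design (D-0017)
set_option linter.dupNamespace false

namespace Summit.NavierStokesRegularity.NavierStokesRegularity.Theorems

open Set Filter Literature.Analysis.FluidPDE Literature.Analysis.FluidPDE.TaoCascade
open scoped Topology

namespace QuadPolar

variable {m : ℕ}

/-! ### The local conservation law -/

/-- **SHELL-ENERGY FLUX IDENTITY**: along any family solving the exact `𝕊`-lattice at every site (scale ratio
`1 + ε₀`, nearest-neighbour slot-closed `𝕊`, table cancelling on `𝕊`), the shell energy `e_n(t) = ½ Σᵢ X_{i,n}(t)²`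
has derivative `B_𝕊(n−1)(t) − B_𝕊(n)(t)` (bond flux in minus bond flux out).
[cite: Tao2016AveragedNS, §4 (4.3), (4.9) and proof of Lemma 4.1 (v)] -/
theorem hasDerivAt_shellEnergy {𝕊 : Finset (ℤ × ℤ × ℤ)} (h𝕊 : IsNearestNeighbourSet 𝕊) (h𝕊' : IsSlotClosed 𝕊)
    (ε₀ : ℝ) {α : Fin m → Fin m → Fin m → ℤ × ℤ × ℤ → ℝ} (hα : IsCancellingCoeffOn 𝕊 α)
    {X : Fin m → ℤ → ℝ → ℝ} {n : ℤ} {t : ℝ} (hX : ∀ i, HasDerivAt (X i n) (quadTermOn 𝕊 ε₀ α X i n t) t) :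
    HasDerivAt (fun s => ∑ i, X i n s ^ 2 / 2) (botSumOn 𝕊 ε₀ α X (n - 1) t - botSumOn 𝕊 ε₀ α X n t) t := by
  have h1 : HasDerivAt (fun s => ∑ i, X i n s ^ 2 / 2) (∑ i, quadTermOn 𝕊 ε₀ α X i n t * X i n t) t := by
    refine HasDerivAt.fun_sum fun i _ => ?_
    have h := ((hX i).pow 2).div_const 2
    refine h.congr_deriv ?_
    simp only [Nat.cast_ofNat]
    ring
  have htop : topSumOn 𝕊 ε₀ α X n t = -botSumOn 𝕊 ε₀ α X n t := by
    rw [botSumOn_eq_neg_topSumOn h𝕊' h𝕊.out_eq_zero_or_one ε₀ hα X n t, neg_neg]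
  rw [sum_quadTermOn_mul h𝕊.out_eq_zero_or_one, htop] at h1
  convert h1 using 1
  ring

/-- Integrated flux identity: `e_n(t) − e_n(s) = ∫ₛᵗ (B(n−1) − B(n))` along a family solving the lattice everywhere
with continuous amplitudes on the shells `n−1, n, n+1` (automatic: they are differentiable).
[cite: Tao2016AveragedNS, §4 (4.9) and proof of Lemma 4.1 (v)] -/
theorem shellEnergy_sub_eq_integral {𝕊 : Finset (ℤ × ℤ × ℤ)} (h𝕊 : IsNearestNeighbourSet 𝕊)
    (h𝕊' : IsSlotClosed 𝕊) (ε₀ : ℝ) {α : Fin m → Fin m → Fin m → ℤ × ℤ × ℤ → ℝ} (hα : IsCancellingCoeffOn 𝕊 α)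
    {X : Fin m → ℤ → ℝ → ℝ} (hX : ∀ i k t, HasDerivAt (X i k) (quadTermOn 𝕊 ε₀ α X i k t) t) (n : ℤ) (s t : ℝ) :
    ∑ i, X i n t ^ 2 / 2 - ∑ i, X i n s ^ 2 / 2 =
      ∫ σ in s..t, (botSumOn 𝕊 ε₀ α X (n - 1) σ - botSumOn 𝕊 ε₀ α X n σ) := by
  have hXc : ∀ j k, Continuous (X j k) := fun j k => continuous_iff_continuousAt.2 fun τ => (hX j k τ).continuousAt
  have hbc : ∀ k, Continuous fun σ => botSumOn 𝕊 ε₀ α X k σ := fun k => by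
    have h := continuousOn_botSumOn 𝕊 ε₀ α (S := X) (I := univ) (fun j k' => (hXc j k').continuousOn) k
    exact continuousOn_univ.mp h
  symm
  exact intervalIntegral.integral_eq_sub_of_hasDerivAt
    (fun σ _ => hasDerivAt_shellEnergy h𝕊 h𝕊' ε₀ hα fun i => hX i n σ)
    (((hbc (n - 1)).sub (hbc n)).intervalIntegrable _ _)

/-! ### The bond flux of the mirror table -/

/-- A sum over the bond-crossing classes of `S♭` is the sum of its three terms.
[cite: Tao2016AveragedNS, §4 proof of Lemma 4.1 (v) and p. 9 footnote 7; cell vocabulary] -/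
theorem sum_botShifts_shiftSetFlat {M : Type*} [AddCommMonoid M] (f : ℤ × ℤ × ℤ → M) :
    ∑ μ ∈ botShifts shiftSetFlat, f μ = f (0, 0, 1) + f (1, 0, 1) + f (0, 1, 1) := by
  rw [botShifts_shiftSetFlat]
  simp [Finset.sum_insert, add_assoc]

/-- **Bond flux of the mirror table**: `B_{S♭}(n) = (1+ε₀)^{5n/2}·(a_{n+1} v_n² + δ a_{n+1}² v_n)` — the Toda class
`(v,v,a)@(0,0,1)` carries `a_{n+1}v_n²`, the two bond-crossing mirror classes `(a,v,a)@(1,0,1)`, `(v,a,a)@(0,1,1)` carry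
`δ/2 · a_{n+1}² v_n` each. [cite: Tao2016AveragedNS, §4 proof of Lemma 4.1 (v); route TaoLadderRungTwoFlat, posited table] -/
theorem botSumOn_mirrorTable (ε₀ ε δ : ℝ) (X : Fin 2 → ℤ → ℝ → ℝ) (n : ℤ) (t : ℝ) :
    botSumOn shiftSetFlat ε₀ (mirrorTable ε δ) X n t =
      (1 + ε₀) ^ ((5 : ℝ) * n / 2) * (X 0 (n + 1) t * X 1 n t ^ 2 + δ * X 0 (n + 1) t ^ 2 * X 1 n t) := by
  simp only [botSumOn, fullSumOn, Fin.sum_univ_two, sum_botShifts_shiftSetFlat, mirrorTable]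
  norm_num
  ring

/-- **Amplitude × energy bound of the mirror bond flux**: with `m = max(|a_{n+1}|, |v_n|)`,
`|B_{S♭}(n)| ≤ (1+ε₀)^{5n/2}·m·(v_n² + |δ|·a_{n+1}²)` (`1 + ε₀ > 0`). Energy crosses a bond no faster than the local
amplitude times the local energy. [cite: Tao2016AveragedNS, §4 proof of Lemma 4.1 (v) (the boundary terms); route TaoLadderRungTwoFlat] -/
theorem abs_botSumOn_mirrorTable_le {ε₀ : ℝ} (hε : 0 < 1 + ε₀) (ε δ : ℝ) (X : Fin 2 → ℤ → ℝ → ℝ) (n : ℤ) (t : ℝ) :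
    |botSumOn shiftSetFlat ε₀ (mirrorTable ε δ) X n t| ≤
      (1 + ε₀) ^ ((5 : ℝ) * n / 2) * max |X 0 (n + 1) t| |X 1 n t| * (X 1 n t ^ 2 + |δ| * X 0 (n + 1) t ^ 2) := by
  have hc : 0 < (1 + ε₀) ^ ((5 : ℝ) * n / 2) := Real.rpow_pos_of_pos hε _
  rw [botSumOn_mirrorTable, abs_mul, abs_of_pos hc]
  set a := X 0 (n + 1) t
  set v := X 1 n t
  have ha : |a| ≤ max |a| |v| := le_max_left _ _
  have hv : |v| ≤ max |a| |v| := le_max_right _ _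
  have hm : 0 ≤ max |a| |v| := le_trans (abs_nonneg _) ha
  have key : |a * v ^ 2 + δ * a ^ 2 * v| ≤ max |a| |v| * (v ^ 2 + |δ| * a ^ 2) :=
    calc |a * v ^ 2 + δ * a ^ 2 * v| ≤ |a * v ^ 2| + |δ * a ^ 2 * v| := abs_add_le _ _
      _ = |a| * v ^ 2 + |δ| * a ^ 2 * |v| := by
          rw [abs_mul, abs_mul, abs_mul, abs_pow, abs_pow, sq_abs, sq_abs]
      _ ≤ max |a| |v| * v ^ 2 + |δ| * a ^ 2 * max |a| |v| := by
          gcongr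
      _ = max |a| |v| * (v ^ 2 + |δ| * a ^ 2) := by ring
  calc (1 + ε₀) ^ ((5 : ℝ) * n / 2) * |a * v ^ 2 + δ * a ^ 2 * v|
      ≤ (1 + ε₀) ^ ((5 : ℝ) * n / 2) * (max |a| |v| * (v ^ 2 + |δ| * a ^ 2)) := mul_le_mul_of_nonneg_left key hc.le
    _ = (1 + ε₀) ^ ((5 : ℝ) * n / 2) * max |a| |v| * (v ^ 2 + |δ| * a ^ 2) := by ring

end QuadPolar

namespace MirrorPulse

open QuadPolar

/-- **Flux identity for the λ₀ = 1 mirror lattice**: along an exact global solution `X` of `T♭(ε)`,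
`d/dt ½(a_n² + v_n²) = T_{n−1} − T_n` with `T_n = a_{n+1} v_n² + ε a_{n+1}² v_n = v_n a_{n+1}(v_n + ε a_{n+1})`.
[cite: Tao2016AveragedNS, §4 (4.3), (4.9); route TaoLadderRungTwoFlat, λ₀ = 1 layer] -/
theorem IsGlobalSol.hasDerivAt_shellEnergy {ε : ℝ} {X : Fin 2 → ℤ → ℝ → ℝ} (hX : IsGlobalSol ε X) (n : ℤ) (t : ℝ) :
    HasDerivAt (fun s => ∑ i, X i n s ^ 2 / 2)
      ((X 0 n t * X 1 (n - 1) t ^ 2 + ε * X 0 n t ^ 2 * X 1 (n - 1) t) -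
        (X 0 (n + 1) t * X 1 n t ^ 2 + ε * X 0 (n + 1) t ^ 2 * X 1 n t)) t := by
  have h := QuadPolar.hasDerivAt_shellEnergy isNearestNeighbourSet_shiftSetFlat isSlotClosed_shiftSetFlat 0
    (isCancellingCoeffOn_mirrorTable ε ε) (X := X) (n := n) (t := t) fun i => hX i n t
  rw [botSumOn_mirrorTable, botSumOn_mirrorTable, sub_add_cancel] at h
  simpa using h

end MirrorPulse

end Summit.NavierStokesRegularity.NavierStokesRegularity.Theorems

end
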